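import Mathlib
import Summits.CriticalPhenomena.Ising3DConformalLimit.Theses.PositivityBegetsConformality
import Literature.Probability.LatticeModels.ConformalCovariance
import HarnessLib

/-!
# Translations and the unit inversion beget `O(3)`: `InversionBegetsRotations`

(Item stmt-CriticalPhenomena-4675 `PositivityBegetsConformality.InversionBegetsRotations`, by
name; it is the registered stub `stub_inversionBegetsRotations` of line
`two-shell-exchange-markov` for the crux `MoebiusLimitOfTwoPointLaw`, item
stmt-CriticalPhenomena-4801.)

For every weight `Δ : ℝ` and every correlation family `S : CorrFamily 3` on `ℝ³`, translation
invariance (`IsTranslationInvariant S`) and covariance under the unit inversion `ι y = y/‖y‖²`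
with weight `Δ` (`IsInversionCovariant Δ S`, at configurations avoiding the origin) imply
invariance under EVERY linear isometry of `ℝ³` (`IsRotationInvariant S`: all of `O(3)`, every
configuration). No continuity, no scale covariance and no normalisation are used.

Proof.
* Möbius geometry (`inversion_inversion_sub_add`): for a unit vector `a` and `y ∉ {0, a}`,
  `ι (ι y − a) + a = ι (R_a y)` where `R_a y = y + (1 − 2⟪y, a⟫) a` is the reflection in the
  affine plane `{⟪·, a⟫ = 1/2}` (the unit inversion maps the unit sphere about `a`, which passes
  through `0`, onto that plane, so it conjugates the inversion `τ_a ∘ ι ∘ τ_{−a}` in that sphere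
  into the reflection in the plane). Hence `R_a = ι ∘ τ_a ∘ ι ∘ τ_{−a} ∘ ι` off the poles
  `{0, a}`, and the three conformal weights multiply to one:
  `‖ι (ι y − a) + a‖ · ‖ι y − a‖ · ‖y‖ = 1` (`weight_eq_one`).
* So `S n (R_a ∘ x) = S n x` for configurations avoiding both poles
  (`apply_affineReflect_of_ne`): three uses of inversion covariance, two of translation
  invariance. An arbitrary configuration is first translated off the finitely many pole
  positions; this turns `R_a` into the linear reflection `y ↦ y − 2⟪y, a⟫ a` up to a translation
  (`apply_reflect_unit`).
* These linear reflections are Mathlib's `(ℝ ∙ v)ᗮ.reflection`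
  (`reflection_orthogonal_singleton_eq`), which generate `O(3)` (Cartan–Dieudonné,
  `LinearIsometryEquiv.reflections_generate_dim`); induct on the word
  (`stub_inversionBegetsRotations`).

Translation invariance is load-bearing
(`Theorems/MoebiusLimitOfTwoPointLaw/Negative/GroupLemmaNeedsTranslation.lean`).

References: P. Di Francesco, P. Mathieu, D. Sénéchal, *Conformal Field Theory* (Springer 1997),
§4.1 (the conformal group of `ℝ^d`; special conformal transformations are `ι ∘ τ_b ∘ ι`);
R. Benedetti, C. Petronio, *Lectures on Hyperbolic Geometry* (Springer 1992), ch. A (the Möbius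
group and inversions). Nothing here is specific to the Ising model.
-/

noncomputable section

open Literature.Probability.LatticeModels EuclideanGeometry Submodule

namespace Summit.CriticalPhenomena.Ising3DConformalLimit.PrecisionLaplacianMoebiusLimitOfTwoPointLaw

/-! ### The unit inversion of `ℝ³` -/

/-- The unit inversion is `y ↦ ‖y‖⁻² • y` (also at `y = 0`, where both sides vanish).
[folklore] -/
theorem inversion_zero_one_eq_smul (y : EuclideanSpace ℝ (Fin 3)) :
    inversion 0 1 y = (‖y‖ ^ 2)⁻¹ • y := by
  rw [inversion, dist_eq_norm, vsub_eq_sub, sub_zero, vadd_eq_add, add_zero, div_pow, one_pow,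
    one_div]

/-- `‖ι y‖ = ‖y‖⁻¹` for the unit inversion `ι`. [folklore] -/
theorem norm_inversion_zero_one (y : EuclideanSpace ℝ (Fin 3)) : ‖inversion 0 1 y‖ = ‖y‖⁻¹ := by
  have h := dist_inversion_center (0 : EuclideanSpace ℝ (Fin 3)) y 1
  rwa [dist_zero_right, dist_zero_right, one_pow, one_div] at h

/-- A unit vector is fixed by the unit inversion. [folklore] -/
theorem inversion_zero_one_of_norm_eq_one {a : EuclideanSpace ℝ (Fin 3)} (ha : ‖a‖ = 1) :
    inversion 0 1 a = a :=
  inversion_of_mem_sphere (by rwa [mem_sphere_zero_iff_norm])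

/-! ### The reflection in the plane `{⟪·, a⟫ = 1/2}` as a threefold inversion -/

/-- The affine reflection `R_a y = y + (1 − 2⟪y, a⟫) a` in the plane `{⟪·, a⟫ = 1/2}` (`a` a unit
vector) swaps `0` and `a`, whence `‖R_a y‖ = ‖y − a‖`. [folklore] -/
theorem norm_affineReflect {a : EuclideanSpace ℝ (Fin 3)} (ha : ‖a‖ = 1)
    (y : EuclideanSpace ℝ (Fin 3)) : ‖y + (1 - 2 * inner ℝ y a) • a‖ = ‖y - a‖ := by
  have h : ‖y + (1 - 2 * inner ℝ y a) • a‖ ^ 2 = ‖y - a‖ ^ 2 := by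
    rw [norm_add_sq_real, norm_sub_sq_real, norm_smul, real_inner_smul_right, ha, mul_one,
      Real.norm_eq_abs, sq_abs, one_pow]
    ring
  exact (pow_left_inj₀ (norm_nonneg _) (norm_nonneg _) two_ne_zero).1 h

/-- `‖ι y − a‖ = ‖y − a‖ / ‖y‖` for a unit vector `a` and `y ≠ 0` (`ι a = a` and the distance
formula for inverted points). [folklore] -/
theorem norm_inversion_sub_unit {a y : EuclideanSpace ℝ (Fin 3)} (ha : ‖a‖ = 1) (hy0 : y ≠ 0) :
    ‖inversion 0 1 y - a‖ = ‖y - a‖ / ‖y‖ := by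
  have ha0 : a ≠ 0 := by rw [← norm_ne_zero_iff, ha]; exact one_ne_zero
  have h := dist_inversion_inversion (c := (0 : EuclideanSpace ℝ (Fin 3))) hy0 ha0 1
  rw [inversion_zero_one_of_norm_eq_one ha, dist_zero_right, dist_zero_right, dist_eq_norm,
    dist_eq_norm, ha, mul_one, one_pow] at h
  rw [h, div_mul_eq_mul_div, one_mul]

/-- **Key identity** `ι (ι y − a) + a = ι (R_a y)` off the poles `{0, a}` (`a` a unit vector):
the inversion `τ_a ∘ ι ∘ τ_{−a}` in the unit sphere about `a` is conjugated by `ι` into the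
reflection `R_a` in the plane `{⟪·, a⟫ = 1/2}`, the `ι`-image of that sphere. Brute force: with
`r = ‖y‖²`, `t = ⟪y, a⟫`, `D = ‖y − a‖² = r − 2t + 1`, both sides equal `D⁻¹ y + ((1 − 2t)/D) a`.
[folklore] -/
theorem inversion_inversion_sub_add {a y : EuclideanSpace ℝ (Fin 3)} (ha : ‖a‖ = 1)
    (hy0 : y ≠ 0) (hya : y ≠ a) :
    inversion 0 1 (inversion 0 1 y - a) + a = inversion 0 1 (y + (1 - 2 * inner ℝ y a) • a) := by
  have hr : (0 : ℝ) < ‖y‖ ^ 2 := by positivity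
  have hD : (0 : ℝ) < ‖y - a‖ ^ 2 := by
    have : 0 < ‖y - a‖ := norm_pos_iff.2 (sub_ne_zero.2 hya)
    positivity
  have hDe : ‖y - a‖ ^ 2 = ‖y‖ ^ 2 - 2 * inner ℝ y a + 1 := by rw [norm_sub_sq_real, ha, one_pow]
  rw [inversion_zero_one_eq_smul (inversion 0 1 y - a), norm_inversion_sub_unit ha hy0,
    inversion_zero_one_eq_smul y, inversion_zero_one_eq_smul, norm_affineReflect ha, div_pow]
  have e1 : (‖y - a‖ ^ 2 / ‖y‖ ^ 2)⁻¹ * (‖y‖ ^ 2)⁻¹ = (‖y - a‖ ^ 2)⁻¹ := by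
    field_simp
  have e2 : (‖y - a‖ ^ 2)⁻¹ * (1 - 2 * inner ℝ y a) = 1 - (‖y - a‖ ^ 2 / ‖y‖ ^ 2)⁻¹ := by
    rw [hDe] at hD ⊢
    field_simp
    ring
  rw [smul_sub, smul_smul, e1, smul_add, smul_smul, e2, sub_smul, one_smul]
  abel

/-- **The three conformal weights multiply to one**: `‖ι (ι y − a) + a‖ · ‖ι y − a‖ · ‖y‖ = 1`
off the poles. [folklore] -/
theorem weight_eq_one {a y : EuclideanSpace ℝ (Fin 3)} (ha : ‖a‖ = 1) (hy0 : y ≠ 0)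
    (hya : y ≠ a) :
    ‖inversion 0 1 (inversion 0 1 y - a) + a‖ * ‖inversion 0 1 y - a‖ * ‖y‖ = 1 := by
  have h1 : ‖y‖ ≠ 0 := norm_ne_zero_iff.2 hy0
  have h2 : ‖y - a‖ ≠ 0 := norm_ne_zero_iff.2 (sub_ne_zero.2 hya)
  rw [inversion_inversion_sub_add ha hy0 hya, norm_inversion_zero_one, norm_affineReflect ha,
    norm_inversion_sub_unit ha hy0]
  field_simp

/-- Off the poles, `R_a y = ι (ι (ι y − a) + a)`, i.e. `R_a = ι ∘ τ_a ∘ ι ∘ τ_{−a} ∘ ι`.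
[folklore] -/
theorem affineReflect_eq_inversion {a y : EuclideanSpace ℝ (Fin 3)} (ha : ‖a‖ = 1)
    (hy0 : y ≠ 0) (hya : y ≠ a) :
    y + (1 - 2 * inner ℝ y a) • a = inversion 0 1 (inversion 0 1 (inversion 0 1 y - a) + a) := by
  rw [inversion_inversion_sub_add ha hy0 hya, inversion_inversion _ one_ne_zero]

/-! ### Correlation families -/

variable {S : CorrFamily 3} {Δ : ℝ}

/-- For a unit vector `a` and a configuration avoiding both poles `0` and `a`, a
translation-invariant, inversion-covariant family is invariant under the affine reflection
`R_a`: inversion covariance three times, translation invariance twice, and the weights cancel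
(`weight_eq_one`). [folklore] -/
theorem apply_affineReflect_of_ne (htr : IsTranslationInvariant S)
    (hinv : IsInversionCovariant Δ S) {a : EuclideanSpace ℝ (Fin 3)} (ha : ‖a‖ = 1) {n : ℕ}
    (x : Fin n → EuclideanSpace ℝ (Fin 3)) (hx0 : ∀ i, x i ≠ 0) (hxa : ∀ i, x i ≠ a) :
    S n (fun i => x i + (1 - 2 * inner ℝ (x i) a) • a) = S n x := by
  have key : ∀ i, ‖inversion 0 1 (inversion 0 1 (x i) - a) + a‖ *
      ‖inversion 0 1 (x i) - a‖ * ‖x i‖ = 1 :=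
    fun i => weight_eq_one ha (hx0 i) (hxa i)
  have hz0 : ∀ i, inversion 0 1 (x i) - a ≠ 0 := fun i h => by
    have h1 := key i
    rw [h, norm_zero, mul_zero, zero_mul] at h1
    exact zero_ne_one h1
  have hw0 : ∀ i, inversion 0 1 (inversion 0 1 (x i) - a) + a ≠ 0 := fun i h => by
    have h1 := key i
    rw [h, norm_zero, zero_mul, zero_mul] at h1
    exact zero_ne_one h1
  have hcfg : (fun i => x i + (1 - 2 * inner ℝ (x i) a) • a) =
      fun i => inversion 0 1 (inversion 0 1 (inversion 0 1 (x i) - a) + a) :=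
    funext fun i => affineReflect_eq_inversion ha (hx0 i) (hxa i)
  have h2 : S n (fun i => inversion 0 1 (x i) - a) = S n (fun i => inversion 0 1 (x i)) := by
    have h := htr n (-a) (fun i => inversion 0 1 (x i))
    simpa only [sub_eq_add_neg] using h
  have h3 : (∏ i, ‖inversion 0 1 (inversion 0 1 (x i) - a) + a‖ ^ (2 * Δ)) *
      (∏ i, ‖inversion 0 1 (x i) - a‖ ^ (2 * Δ)) * (∏ i, ‖x i‖ ^ (2 * Δ)) = 1 := by
    rw [← Finset.prod_mul_distrib, ← Finset.prod_mul_distrib]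
    refine Finset.prod_eq_one fun i _ => ?_
    rw [← Real.mul_rpow (norm_nonneg _) (norm_nonneg _),
      ← Real.mul_rpow (mul_nonneg (norm_nonneg _) (norm_nonneg _)) (norm_nonneg _), key i,
      Real.one_rpow]
  rw [hcfg, hinv n _ hw0, htr n a (fun i => inversion 0 1 (inversion 0 1 (x i) - a)),
    hinv n _ hz0, h2, hinv n x hx0, ← mul_assoc, ← mul_assoc, h3, one_mul]

/-- For a unit vector `a`, a translation-invariant, inversion-covariant family is invariant under
the LINEAR reflection `y ↦ y − 2⟪y, a⟫ a` at EVERY configuration: translate the configuration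
off the finitely many pole positions first (`R_a (y + u) = (y − 2⟪y, a⟫ a) + R_a u`).
[folklore] -/
theorem apply_reflect_unit (htr : IsTranslationInvariant S) (hinv : IsInversionCovariant Δ S)
    {a : EuclideanSpace ℝ (Fin 3)} (ha : ‖a‖ = 1) {n : ℕ}
    (x : Fin n → EuclideanSpace ℝ (Fin 3)) :
    S n (fun i => x i - (2 * inner ℝ (x i) a) • a) = S n x := by
  have ha0 : a ≠ 0 := by rw [← norm_ne_zero_iff, ha]; exact one_ne_zero
  haveI : Infinite (EuclideanSpace ℝ (Fin 3)) :=
    Infinite.of_injective (fun c : ℝ => c • a) (smul_left_injective ℝ ha0)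
  obtain ⟨u, hu⟩ := Infinite.exists_notMem_finset
    (Finset.univ.image (fun i => -x i) ∪ Finset.univ.image (fun i => a - x i))
  simp only [Finset.mem_union, Finset.mem_image, Finset.mem_univ, true_and, not_or,
    not_exists] at hu
  have hu0 : ∀ i, x i + u ≠ 0 := fun i h => hu.1 i (add_eq_zero_iff_neg_eq.1 h)
  have hua : ∀ i, x i + u ≠ a := fun i h =>
    hu.2 i (sub_eq_iff_eq_add.2 (h.symm.trans (add_comm _ _)))
  have key := apply_affineReflect_of_ne htr hinv ha (fun i => x i + u) hu0 hua
  rw [htr n u x] at key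
  have hcfg : (fun i => x i + u + (1 - 2 * inner ℝ (x i + u) a) • a) =
      fun i => (x i - (2 * inner ℝ (x i) a) • a) + (u + (1 - 2 * inner ℝ u a) • a) := by
    funext i
    rw [inner_add_left]
    module
  rw [hcfg, htr n _ (fun i => x i - (2 * inner ℝ (x i) a) • a)] at key
  exact key

/-- Mathlib's reflection in the plane orthogonal to `v` is `y ↦ y − (2⟪y, v⟫/‖v‖²) v` (also for
`v = 0`, where it is the identity). [folklore] -/
theorem reflection_orthogonal_singleton_eq (v y : EuclideanSpace ℝ (Fin 3)) :
    (ℝ ∙ v)ᗮ.reflection y = y - (2 * inner ℝ y v / ‖v‖ ^ 2) • v := by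
  rw [reflection_orthogonal_apply, reflection_singleton_apply, real_inner_comm y v, two_smul,
    neg_sub, ← add_smul]
  simp only [RCLike.ofReal_real_eq_id, id_eq]
  congr 2
  ring

/-- A translation-invariant, inversion-covariant family is invariant under every hyperplane
reflection `(ℝ ∙ v)ᗮ.reflection` of `ℝ³`. [folklore] -/
theorem apply_reflection (htr : IsTranslationInvariant S) (hinv : IsInversionCovariant Δ S)
    (v : EuclideanSpace ℝ (Fin 3)) {n : ℕ} (x : Fin n → EuclideanSpace ℝ (Fin 3)) :
    S n (fun i => (ℝ ∙ v)ᗮ.reflection (x i)) = S n x := by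
  simp only [reflection_orthogonal_singleton_eq]
  by_cases hv : v = 0
  · simp [hv]
  · have hnv : ‖v‖ ≠ 0 := norm_ne_zero_iff.2 hv
    have ha : ‖‖v‖⁻¹ • v‖ = 1 := by
      rw [norm_smul, norm_inv, norm_norm, inv_mul_cancel₀ hnv]
    have hcfg : (fun i => x i - (2 * inner ℝ (x i) v / ‖v‖ ^ 2) • v) =
        fun i => x i - (2 * inner ℝ (x i) (‖v‖⁻¹ • v)) • ‖v‖⁻¹ • v := by
      funext i
      rw [real_inner_smul_right, smul_smul]
      congr 2
      field_simp
    rw [hcfg, apply_reflect_unit htr hinv ha x]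

/-- **Item `InversionBegetsRotations` (stmt-CriticalPhenomena-4675), the group lemma.** For every
`Δ : ℝ` and every `S : CorrFamily 3`,
`IsTranslationInvariant S → IsInversionCovariant Δ S → IsRotationInvariant S`: translations and
the unit inversion `y ↦ y/‖y‖²` (weight `∏ ‖xᵢ‖^{2Δ}`, configurations off the origin) force
invariance under all of `O(3)` at every configuration — every linear isometry of `ℝ³` is a
product of hyperplane reflections (Cartan–Dieudonné,
`LinearIsometryEquiv.reflections_generate_dim`), and each reflection is, off two poles and up to
translations, the threefold inversion `ι ∘ τ_a ∘ ι ∘ τ_{−a} ∘ ι` with total weight `1`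
(`apply_reflection`). (Di Francesco–Mathieu–Sénéchal 1997, §4.1; Benedetti–Petronio 1992, ch. A.)
[folklore] -/
theorem stub_inversionBegetsRotations :
    Summit.CriticalPhenomena.Ising3DConformalLimit.Theses.PositivityBegetsConformality.InversionBegetsRotations := by
  intro Δ S htr hinv n R x
  obtain ⟨l, -, rfl⟩ := R.reflections_generate_dim
  induction l generalizing x with
  | nil => simp
  | cons v l ih =>
    simp only [List.map_cons, List.prod_cons, LinearIsometryEquiv.coe_mul, Function.comp_apply]
    rw [apply_reflection htr hinv v (fun i => (l.map fun w => (ℝ ∙ w)ᗮ.reflection).prod (x i)), ih]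

end Summit.CriticalPhenomena.Ising3DConformalLimit.PrecisionLaplacianMoebiusLimitOfTwoPointLaw

end
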